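import Mathlib
import Summits.ValiantsHypothesis.ValiantsHypothesis.Theorems.ValuativeGCTValuativeFlipBinaryFormsDeterminantal
import Summits.ValiantsHypothesis.ValiantsHypothesis.Theorems.ValuativeGCTValuativeFlipFewRowPlethysmCap

/-!
# `Det_m` is equation-free on two letters: `K_m(λ*) = a_λ(δ[m])` for `ℓ(λ) ≤ 2`

Crux `ValuativeGCT.ValuativeFlip` (stmt-ValiantsHypothesis-12624), wall-breaker axis 14
("plethysm tables, small cases certified"), third file of the few-row table: the determinant
column of the row-`≤ 2` entries.

A torus weight vector `F` of `ℂ[Sym^m ℂ^{m²}]` whose weight is supported on a set `S` of at most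
two letters only involves the coordinates of monomials in the letters `S` (locality of weight
vectors, `NoValuativeFlip.aeval_formCoeff_eq_of_mem_weightSpace`), and every form of degree `m` in
two letters lies in `Δ(det_m)` (`linSubst_mem_orbitClosure_detFormLex_of_card_le_two`, binary forms
are determinantal); so if `F` vanishes on `Δ(det_m)` it vanishes at every point of `Sym^m` and is
zero (`weightVector_eq_zero_of_mem_orbitVanishingIdeal_det_of_card_le_two`).  Hence the quotient
map `HWV_χ(ℂ[Sym^m]) → HWV_χ(ℂ[Δ(det_m)])` is injective as well as surjective (complete
reducibility), and `K_m(χ) = pleth(χ)` for every weight `χ` supported on two letters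
(`orbitMultiplicity_det_eq_plethysmCoeff_of_card_le_two`); for `χ = λ*` with `ℓ(λ) ≤ 2` this is the
`GL_k` plethysm number `a_λ(δ[m]) = plethysmCoeffOfPartition ℂ k m λ` for any `ℓ(λ) ≤ k ≤ m²`
(`orbitMultiplicity_det_eq_plethysmCoeffOfPartition_of_card_parts_le_two`).  Table row `≤ 2`:
`mult_pp(λ*) ≤ K_m(λ*) = a_λ(δ[m])` (with `orbitMultiplicity_paddedPer_le_det_of_card_parts_le_two`
of file `ValuativeGCTValuativeFlipTwoRowNoFlip`).

References: BLMW, SIAM J. Comput. 40 (2011) §4.4, §5.3; J. M. Landsberg, *Geometry and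
Complexity Theory* (2017) §8.4.
-/

set_option linter.dupNamespace false

noncomputable section

namespace Summit.ValiantsHypothesis.ValiantsHypothesis.Theorems.ValuativeFlip

open MvPolynomial
open scoped BigOperators
open Literature.NumberTheory.DiophantineGeometry Literature.Computability.AlgebraicComplexity

variable {m : ℕ}

/-- Every point of `Sym^m` is the coefficient vector of the form `∑_d c_d x^d`. [folklore] -/
theorem formCoeff_sum_smul_monomial (c : DegIdx (MatIdx m) m → ℂ) :
    formCoeff m (∑ d : DegIdx (MatIdx m) m, c d • monomial d.1 (1 : ℂ)) = c := by
  classical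
  funext d
  rw [formCoeff_apply, coeff_sum]
  simp only [coeff_smul, coeff_monomial, smul_eq_mul, mul_ite, mul_one, mul_zero]
  rw [Finset.sum_eq_single d]
  · simp
  · intro e _ hed
    rw [if_neg (fun h => hed (Subtype.ext h))]
  · intro h; exact absurd (Finset.mem_univ d) h

/-- The form `∑_d c_d x^d` over degree-`m` monomials is homogeneous of degree `m`. [folklore] -/
theorem isHomogeneous_sum_smul_monomial (c : DegIdx (MatIdx m) m → ℂ) :
    (∑ d : DegIdx (MatIdx m) m, c d • monomial d.1 (1 : ℂ)).IsHomogeneous m := by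
  classical
  refine IsHomogeneous.sum _ _ _ fun d _ => ?_
  rw [smul_eq_C_mul]
  exact (isHomogeneous_monomial _ (mem_degMonomials_iff.mp d.2)).C_mul _

/-- **A weight vector supported on two letters that vanishes on `Δ(det_m)` is zero.** For
`m ≥ 1`, `S` a set of at most two letters, `χ` a weight vanishing outside `S`, and `F` a torus
weight vector of weight `χ` in `ℂ[Sym^m ℂ^{m²}]`: if `F ∈ I(Δ(det_m))` then `F = 0`. Indeed `F`
takes the same value at a form `q` and at its projection `π_S q` onto the letters `S`
(`aeval_formCoeff_eq_of_mem_weightSpace`), `π_S q ∈ Δ(det_m)`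
(`linSubst_mem_orbitClosure_detFormLex_of_card_le_two`), where `F` vanishes
(`orbitVanishingIdeal_le_of_mem_orbitClosure`); so `F` vanishes at every point of `Sym^m`
(`MvPolynomial.funext`). BLMW 2011 §4.4, §5.3. -/
theorem weightVector_eq_zero_of_mem_orbitVanishingIdeal_det_of_card_le_two [NeZero m]
    (S : Finset (MatIdx m)) (hS : S.card ≤ 2) {χ : Weight (MatIdx m)} (hχ : ∀ i, i ∉ S → χ i = 0)
    {F : MvPolynomial (DegIdx (MatIdx m) m) ℂ} (hF : F ∈ weightSpace (coordRep (MatIdx m) ℂ m) χ)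
    (hFI : F ∈ orbitVanishingIdeal (detFormLex ℂ m) m) : F = 0 := by
  classical
  apply MvPolynomial.funext
  intro c
  rw [map_zero]
  set q : MvPolynomial (MatIdx m) ℂ := ∑ d : DegIdx (MatIdx m) m, c d • monomial d.1 (1 : ℂ) with hq
  have hcq : formCoeff m q = c := formCoeff_sum_smul_monomial c
  set D : Matrix (MatIdx m) (MatIdx m) ℂ := Matrix.diagonal fun i => if i ∈ S then (1 : ℂ) else 0
    with hD
  have hrows : ∀ i, i ∉ S → ∀ j, D i j = 0 := by
    intro i hi j
    rw [hD, Matrix.diagonal_apply, if_neg hi]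
    split_ifs <;> rfl
  have hmem : linSubst (MatIdx m) ℂ D q ∈ orbitClosure (detFormLex ℂ m) :=
    linSubst_mem_orbitClosure_detFormLex_of_card_le_two (isHomogeneous_sum_smul_monomial c) S hS D
      hrows
  have hFI' := orbitVanishingIdeal_le_of_mem_orbitClosure (m := m) hmem hFI
  have h1 := mem_orbitVanishingIdeal_iff.mp hFI' 1
  simp only [map_one, Module.End.one_apply] at h1
  change aeval c F = 0
  rw [← hcq, NoValuativeFlip.aeval_formCoeff_eq_of_mem_weightSpace S hχ hF q]
  exact h1

/-- **`Det_m` is equation-free on two letters: `K_m(χ) = pleth(χ)`** for every weight `χ` of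
`GL_{m²}` supported on at most two letters (`m ≥ 1`): the quotient map from the highest-weight
space of `ℂ[Sym^m ℂ^{m²}]` at `χ` onto that of `ℂ[Δ(det_m)]` (surjective by complete reducibility,
`map_highestWeightSpace_eq_of_surjective`) is injective
(`weightVector_eq_zero_of_mem_orbitVanishingIdeal_det_of_card_le_two`). BLMW 2011 §4.4, §5.3. -/
theorem orbitMultiplicity_det_eq_plethysmCoeff_of_card_le_two [NeZero m] (S : Finset (MatIdx m))
    (hS : S.card ≤ 2) (χ : Weight (MatIdx m)) (hχ : ∀ i, i ∉ S → χ i = 0) :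
    orbitMultiplicity ℂ (detFormLex ℂ m) m χ = plethysmCoeff ℂ (MatIdx m) m χ := by
  classical
  set V : Submodule ℂ (MvPolynomial (DegIdx (MatIdx m) m) ℂ) :=
    highestWeightSpace (coordRep (MatIdx m) ℂ m) χ with hV
  haveI : FiniteDimensional ℂ V :=
    finiteDimensional_highestWeightSpace_coordRep_holds (NeZero.ne m) χ
  let π : (coordRep (MatIdx m) ℂ m).IntertwiningMap (orbitCoordRep (detFormLex ℂ m) m) :=
    ⟨(Ideal.Quotient.mkₐ ℂ (orbitVanishingIdeal (detFormLex ℂ m) m)).toLinearMap,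
      fun _ => LinearMap.ext fun _ => rfl⟩
  have hmap := map_highestWeightSpace_eq_of_surjective π (Ideal.Quotient.mkₐ_surjective ℂ _)
    (isSemisimpleRepresentation_coordRep m) χ
  have hr := LinearMap.finrank_range_add_finrank_ker (π.toLinearMap ∘ₗ V.subtype)
  rw [LinearMap.range_comp, Submodule.range_subtype] at hr
  have hker : LinearMap.ker (π.toLinearMap ∘ₗ V.subtype) = ⊥ := by
    rw [Submodule.eq_bot_iff]
    intro F hF0
    rw [LinearMap.mem_ker, LinearMap.comp_apply] at hF0
    have hFI : (F : MvPolynomial (DegIdx (MatIdx m) m) ℂ) ∈ orbitVanishingIdeal (detFormLex ℂ m) m :=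
      Ideal.Quotient.eq_zero_iff_mem.mp hF0
    exact Subtype.ext (weightVector_eq_zero_of_mem_orbitVanishingIdeal_det_of_card_le_two S hS hχ
      (highestWeightSpace_le_weightSpace _ _ F.2) hFI)
  rw [hker, finrank_bot, add_zero] at hr
  unfold orbitMultiplicity plethysmCoeff hwMultiplicity
  rw [← hmap, ← hV]
  exact hr

/-- **Row `≤ 2` of the few-row table, determinant column: `K_m(λ*) = a_λ(δ[m])`.** For
`λ ⊢ d` with `ℓ(λ) ≤ 2` and any `k` with `ℓ(λ) ≤ k ≤ m²`, the multiplicity of `λ*` in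
`ℂ[Δ(det_m)]` equals the `GL_k` plethysm coefficient `plethysmCoeffOfPartition ℂ k m λ`
(`orbitMultiplicity_det_eq_plethysmCoeff_of_card_le_two` on the last `ℓ(λ)` letters, then
`plethysmCoeff_toMatIdx_eq_plethysmCoeffOfPartition`). With
`orbitMultiplicity_paddedPer_le_det_of_card_parts_le_two`: on shapes with at most two rows the
per side of the crux is at most, and the det-side multiplicity is exactly, `a_λ(δ[m])`. -/
theorem orbitMultiplicity_det_eq_plethysmCoeffOfPartition_of_card_parts_le_two {m : ℕ} [NeZero m]
    {k d : ℕ} (hk : k ≤ m * m) (lam : Nat.Partition d) (h2 : lam.parts.card ≤ 2)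
    (hlam : lam.parts.card ≤ k) :
    orbitMultiplicity ℂ (detFormLex ℂ m) m (Weight.dualOfPartition (m * m) lam).toMatIdx =
      plethysmCoeffOfPartition ℂ k m lam := by
  classical
  rw [← plethysmCoeff_toMatIdx_eq_plethysmCoeffOfPartition hk lam hlam]
  set ρ := lam.parts.card with hρ
  have hρm : ρ ≤ m * m := hlam.trans hk
  let S : Finset (MatIdx m) := Finset.univ.image fun t : Fin ρ =>
    matIdxEquiv m ⟨m * m - 1 - t, by have := t.2; omega⟩
  have hScard : S.card ≤ 2 := Finset.card_image_le.trans (by simpa using h2)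
  have hχ : ∀ i, i ∉ S → (Weight.dualOfPartition (m * m) lam).toMatIdx i = 0 := by
    intro i hi
    obtain ⟨i', rfl⟩ : ∃ i' : Fin (m * m), matIdxEquiv m i' = i :=
      ⟨(matIdxEquiv m).symm i, (matIdxEquiv m).apply_symm_apply i⟩
    by_cases hlt : (i' : ℕ) + ρ < m * m
    · exact NoValuativeFlip.dualOfPartition_toMatIdx_eq_zero_of_lt lam i' hlt
    · exfalso
      apply hi
      refine Finset.mem_image.mpr ⟨⟨m * m - 1 - i', by omega⟩, Finset.mem_univ _, ?_⟩
      congr 1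
      exact Fin.ext (by simp; omega)
  exact orbitMultiplicity_det_eq_plethysmCoeff_of_card_le_two S hScard _ hχ

end Summit.ValiantsHypothesis.ValiantsHypothesis.Theorems.ValuativeFlip

end
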